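import Summits.ValiantsHypothesis.ValiantsHypothesis.Theorems.LacunarySymmetroidMatrixDescartesCensusTetranomialStaircase

/-!
# `MatrixDescartes` census — the T4 double-root BRANCH: identities, derivatives, and «below its chords» (convexity in log–log)

HONEST FRAMING.  Object-search cell `pub-symmetroid`; door-A item `Theses.LacunarySymmetroid.DoorA26 = PosRootLawAt 2 6 19`
(stmt-ValiantsHypothesis-19979; OPEN, typed, never asserted).  Third ingredient of the «T4» window rows (val-sym-door-p4 g10), after
`…CensusTetranomialStaircase` (staircase) and `…CensusTetranomialWindow` / `…Row` (product form): the CHORD rows.  Along the upper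
double-root branch `ξ ↦ (γ(ξ), β(ξ))` of `1 − βx^a + γx^b − x^c` (`β(ξ) = (b + (c−b)ξ^c)/((b−a)ξ^a)`, `γ(ξ) = (a + (c−a)ξ^c)/((b−a)ξ^b)`,
`ξ^c > ab/((c−a)(c−b))`) one has `d ln β / d ln γ = (a + (c−a)ξ^c)/(b + (c−b)ξ^c)`, an INCREASING function of `ξ` — so `ln β` is a CONVEX
function of `ln γ` along the branch, and a point of the three-root region under a slab `γ(ξ₁) ≤ γ ≤ γ(ξ₂)` lies below the CHORD:

* `branch_tet_eval`, `branch_twi_eval`, `branch_upper_cond` — the branch point IS a double-root certificate of the staircase lemma;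
* `hasDerivAt_logBeta`, `hasDerivAt_logGamma` — `(ln β)′ = N/(ξ(b + (c−b)ξ^c))`, `(ln γ)′ = N/(ξ(a + (c−a)ξ^c))`, `N = (c−a)(c−b)ξ^c − ab`;
* `branch_below_chord` — for `ξ₁ ≤ ξ⋆ ≤ ξ₂` on the upper branch the point `(ln γ(ξ⋆), ln β(ξ⋆))` lies below the chord through the
  endpoints (two mean value theorems; the slope `d ln β/d ln γ = (a + (c−a)ξ^c)/(b + (c−b)ξ^c)` increases).
The chord ROW for a point of the three-root region is in `…CensusTetranomialChord`.  Nothing here bears on `DoorA26`, `MatrixDescartes`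
(18050) or `VP ≠ VNP`.

[folklore] Elementary real analysis for one explicit curve.
-/

-- `Summit.ValiantsHypothesis.ValiantsHypothesis.…` repeats a component by the D-0017 layout
-- (single-conjunct summit), which the `dupNamespace` linter flags; the name is mandated.
set_option linter.dupNamespace false

namespace Summit.ValiantsHypothesis.ValiantsHypothesis.Theorems.LacunarySymmetroidMatrixDescartes.Census.T4

open Polynomial Set

section Chord

variable {a b c : ℕ}

/-- The double-root branch point satisfies the tetranomial equation (identity in `ξ`). [this work] -/
theorem branch_tet_eval (hab : a < b) {ξ : ℝ} (hξ : 0 < ξ) :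
    (C 1 - C (((b : ℝ) + ((c : ℝ) - b) * ξ ^ c) / (((b : ℝ) - a) * ξ ^ a)) * X ^ a
      + C (((a : ℝ) + ((c : ℝ) - a) * ξ ^ c) / (((b : ℝ) - a) * ξ ^ b)) * X ^ b - X ^ c : ℝ[X]).eval ξ = 0 := by
  rw [eval_tet]
  have hba : ((b : ℝ) - a) ≠ 0 := by
    have : (a : ℝ) < b := by exact_mod_cast hab
    linarith
  have hξa : ξ ^ a ≠ 0 := pow_ne_zero _ hξ.ne'
  have hξb : ξ ^ b ≠ 0 := pow_ne_zero _ hξ.ne'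
  field_simp
  ring

/-- The double-root branch point satisfies the twist equation (identity in `ξ`). [this work] -/
theorem branch_twi_eval (hab : a < b) {ξ : ℝ} (hξ : 0 < ξ) :
    (C (-(a : ℝ)) + C (((b : ℝ) - a) * (((a : ℝ) + ((c : ℝ) - a) * ξ ^ c) / (((b : ℝ) - a) * ξ ^ b))) * X ^ b
      - C ((c : ℝ) - a) * X ^ c : ℝ[X]).eval ξ = 0 := by
  rw [eval_twi]
  have hba : ((b : ℝ) - a) ≠ 0 := by
    have : (a : ℝ) < b := by exact_mod_cast hab
    linarith
  have hξb : ξ ^ b ≠ 0 := pow_ne_zero _ hξ.ne'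
  field_simp
  ring

/-- On the upper branch (`ab ≤ (c−a)(c−b)ξ^c`) the branch condition of the staircase lemma holds. [this work] -/
theorem branch_upper_cond (hab : a < b) {ξ : ℝ} (hξ : 0 < ξ)
    (hup : (a : ℝ) * b ≤ ((c : ℝ) - a) * ((c : ℝ) - b) * ξ ^ c) :
    (b : ℝ) * ((b : ℝ) - a) * (((a : ℝ) + ((c : ℝ) - a) * ξ ^ c) / (((b : ℝ) - a) * ξ ^ b)) * ξ ^ b
      ≤ (c : ℝ) * ((c : ℝ) - a) * ξ ^ c := by
  have hba : (0 : ℝ) < (b : ℝ) - a := by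
    have : (a : ℝ) < b := by exact_mod_cast hab
    linarith
  have hξb : 0 < ξ ^ b := pow_pos hξ _
  have e : (b : ℝ) * ((b : ℝ) - a) * (((a : ℝ) + ((c : ℝ) - a) * ξ ^ c) / (((b : ℝ) - a) * ξ ^ b)) * ξ ^ b
      = (b : ℝ) * ((a : ℝ) + ((c : ℝ) - a) * ξ ^ c) := by
    field_simp
  rw [e]
  nlinarith

/-- The log-coordinates of the branch and their derivatives: with `w = ξ^c`, `N = (c−a)(c−b)w − ab`,
`(ln β)′(ξ) = N / (ξ (b + (c−b) w))` and `(ln γ)′(ξ) = N / (ξ (a + (c−a) w))`. [this work] -/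
theorem hasDerivAt_logBeta (ha : 0 < a) (hab : a < b) (hbc : b < c) {ξ : ℝ} (hξ : 0 < ξ) :
    HasDerivAt (fun x : ℝ => Real.log (((b : ℝ) + ((c : ℝ) - b) * x ^ c) / (((b : ℝ) - a) * x ^ a)))
      ((((c : ℝ) - a) * ((c : ℝ) - b) * ξ ^ c - (a : ℝ) * b) / (ξ * ((b : ℝ) + ((c : ℝ) - b) * ξ ^ c))) ξ := by
  have hc : 0 < c := ha.trans (hab.trans hbc)
  have hba : (0 : ℝ) < (b : ℝ) - a := by
    have : (a : ℝ) < b := by exact_mod_cast hab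
    linarith
  have hcb : (0 : ℝ) < (c : ℝ) - b := by
    have : (b : ℝ) < c := by exact_mod_cast hbc
    linarith
  have hnum : 0 < (b : ℝ) + ((c : ℝ) - b) * ξ ^ c := by
    have : (0 : ℝ) < b := by exact_mod_cast (ha.trans hab)
    positivity
  have hden : 0 < ((b : ℝ) - a) * ξ ^ a := mul_pos hba (pow_pos hξ _)
  -- derivative of the inner quotient
  have h1 : HasDerivAt (fun x : ℝ => (b : ℝ) + ((c : ℝ) - b) * x ^ c) (((c : ℝ) - b) * ((c : ℝ) * ξ ^ (c - 1))) ξ := by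
    simpa using ((hasDerivAt_pow c ξ).const_mul ((c : ℝ) - b)).const_add (b : ℝ)
  have h2 : HasDerivAt (fun x : ℝ => ((b : ℝ) - a) * x ^ a) (((b : ℝ) - a) * ((a : ℝ) * ξ ^ (a - 1))) ξ := by
    simpa using (hasDerivAt_pow a ξ).const_mul ((b : ℝ) - a)
  have h3 := (h1.div h2 hden.ne').log (div_pos hnum hden).ne'
  refine h3.congr_deriv ?_
  dsimp only [Pi.div_apply]
  have ea : ξ ^ a = ξ * ξ ^ (a - 1) := by rw [← pow_succ', Nat.sub_add_cancel ha]
  have ec : ξ ^ c = ξ * ξ ^ (c - 1) := by rw [← pow_succ', Nat.sub_add_cancel hc]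
  rw [ea, ec]
  have hξ0 : ξ ≠ 0 := hξ.ne'
  have hq1 : ξ ^ (a - 1) ≠ 0 := pow_ne_zero _ hξ.ne'
  have hq2 : ξ ^ (c - 1) ≠ 0 := pow_ne_zero _ hξ.ne'
  have hba' : (b : ℝ) - a ≠ 0 := hba.ne'
  have hin : (b : ℝ) + ((c : ℝ) - b) * (ξ * ξ ^ (c - 1)) ≠ 0 := by
    have hb0 : (0 : ℝ) < b := by exact_mod_cast (ha.trans hab)
    have := mul_pos hcb (mul_pos hξ (pow_pos hξ (c - 1)))
    linarith
  field_simp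
  ring

/-- Derivative of `ln γ(ξ)` along the branch (see `hasDerivAt_logBeta`). [this work] -/
theorem hasDerivAt_logGamma (ha : 0 < a) (hab : a < b) (hbc : b < c) {ξ : ℝ} (hξ : 0 < ξ) :
    HasDerivAt (fun x : ℝ => Real.log (((a : ℝ) + ((c : ℝ) - a) * x ^ c) / (((b : ℝ) - a) * x ^ b)))
      ((((c : ℝ) - a) * ((c : ℝ) - b) * ξ ^ c - (a : ℝ) * b) / (ξ * ((a : ℝ) + ((c : ℝ) - a) * ξ ^ c))) ξ := by
  have hb : 0 < b := ha.trans hab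
  have hc : 0 < c := hb.trans hbc
  have hba : (0 : ℝ) < (b : ℝ) - a := by
    have : (a : ℝ) < b := by exact_mod_cast hab
    linarith
  have hca : (0 : ℝ) < (c : ℝ) - a := by
    have : (a : ℝ) < c := by exact_mod_cast (hab.trans hbc)
    linarith
  have hnum : 0 < (a : ℝ) + ((c : ℝ) - a) * ξ ^ c := by
    have : (0 : ℝ) < a := by exact_mod_cast ha
    positivity
  have hden : 0 < ((b : ℝ) - a) * ξ ^ b := mul_pos hba (pow_pos hξ _)
  have h1 : HasDerivAt (fun x : ℝ => (a : ℝ) + ((c : ℝ) - a) * x ^ c) (((c : ℝ) - a) * ((c : ℝ) * ξ ^ (c - 1))) ξ := by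
    simpa using ((hasDerivAt_pow c ξ).const_mul ((c : ℝ) - a)).const_add (a : ℝ)
  have h2 : HasDerivAt (fun x : ℝ => ((b : ℝ) - a) * x ^ b) (((b : ℝ) - a) * ((b : ℝ) * ξ ^ (b - 1))) ξ := by
    simpa using (hasDerivAt_pow b ξ).const_mul ((b : ℝ) - a)
  have h3 := (h1.div h2 hden.ne').log (div_pos hnum hden).ne'
  refine h3.congr_deriv ?_
  dsimp only [Pi.div_apply]
  have eb : ξ ^ b = ξ * ξ ^ (b - 1) := by rw [← pow_succ', Nat.sub_add_cancel hb]
  have ec : ξ ^ c = ξ * ξ ^ (c - 1) := by rw [← pow_succ', Nat.sub_add_cancel hc]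
  rw [eb, ec]
  have hξ0 : ξ ≠ 0 := hξ.ne'
  have hq1 : ξ ^ (b - 1) ≠ 0 := pow_ne_zero _ hξ.ne'
  have hq2 : ξ ^ (c - 1) ≠ 0 := pow_ne_zero _ hξ.ne'
  have hba' : (b : ℝ) - a ≠ 0 := hba.ne'
  have hin : (a : ℝ) + ((c : ℝ) - a) * (ξ * ξ ^ (c - 1)) ≠ 0 := by
    have ha0 : (0 : ℝ) < a := by exact_mod_cast ha
    have := mul_pos hca (mul_pos hξ (pow_pos hξ (c - 1)))
    linarith
  field_simp
  ring

/-- **The branch lies below its chords** (convexity of `ln β` against `ln γ` along the upper branch): for `0 < ξ₁ ≤ ξ⋆ ≤ ξ₂` with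
`ab ≤ (c−a)(c−b)ξ₁^c`, `(B(ξ⋆) − B(ξ₁))(C(ξ₂) − C(ξ₁)) ≤ (B(ξ₂) − B(ξ₁))(C(ξ⋆) − C(ξ₁))`, `B = ln β(·)`, `C = ln γ(·)`. [this work] -/
theorem branch_below_chord (ha : 0 < a) (hab : a < b) (hbc : b < c) {ξ₁ ξs ξ₂ : ℝ} (hξ₁ : 0 < ξ₁)
    (h1s : ξ₁ ≤ ξs) (hs2 : ξs ≤ ξ₂) (hup : (a : ℝ) * b ≤ ((c : ℝ) - a) * ((c : ℝ) - b) * ξ₁ ^ c) :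
    (Real.log (((b : ℝ) + ((c : ℝ) - b) * ξs ^ c) / (((b : ℝ) - a) * ξs ^ a))
        - Real.log (((b : ℝ) + ((c : ℝ) - b) * ξ₁ ^ c) / (((b : ℝ) - a) * ξ₁ ^ a)))
      * (Real.log (((a : ℝ) + ((c : ℝ) - a) * ξ₂ ^ c) / (((b : ℝ) - a) * ξ₂ ^ b))
        - Real.log (((a : ℝ) + ((c : ℝ) - a) * ξ₁ ^ c) / (((b : ℝ) - a) * ξ₁ ^ b)))
    ≤ (Real.log (((b : ℝ) + ((c : ℝ) - b) * ξ₂ ^ c) / (((b : ℝ) - a) * ξ₂ ^ a))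
        - Real.log (((b : ℝ) + ((c : ℝ) - b) * ξ₁ ^ c) / (((b : ℝ) - a) * ξ₁ ^ a)))
      * (Real.log (((a : ℝ) + ((c : ℝ) - a) * ξs ^ c) / (((b : ℝ) - a) * ξs ^ b))
        - Real.log (((a : ℝ) + ((c : ℝ) - a) * ξ₁ ^ c) / (((b : ℝ) - a) * ξ₁ ^ b))) := by
  set Bf : ℝ → ℝ := fun x => Real.log (((b : ℝ) + ((c : ℝ) - b) * x ^ c) / (((b : ℝ) - a) * x ^ a)) with hBf
  set Cf : ℝ → ℝ := fun x => Real.log (((a : ℝ) + ((c : ℝ) - a) * x ^ c) / (((b : ℝ) - a) * x ^ b)) with hCf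
  show (Bf ξs - Bf ξ₁) * (Cf ξ₂ - Cf ξ₁) ≤ (Bf ξ₂ - Bf ξ₁) * (Cf ξs - Cf ξ₁)
  have hba : (0 : ℝ) < (b : ℝ) - a := by
    have : (a : ℝ) < b := by exact_mod_cast hab
    linarith
  have hp0 : (0 : ℝ) < (c : ℝ) - b := by
    have : (b : ℝ) < c := by exact_mod_cast hbc
    linarith
  have hq0 : (0 : ℝ) < (c : ℝ) - a := by
    have : (a : ℝ) < c := by exact_mod_cast (hab.trans hbc)
    linarith
  have ha' : (0 : ℝ) < a := by exact_mod_cast ha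
  have hb' : (0 : ℝ) < b := by exact_mod_cast (ha.trans hab)
  -- derivative data
  set N : ℝ → ℝ := fun x => ((c : ℝ) - a) * ((c : ℝ) - b) * x ^ c - (a : ℝ) * b with hN
  set dB : ℝ → ℝ := fun x => N x / (x * ((b : ℝ) + ((c : ℝ) - b) * x ^ c)) with hdB
  set dC : ℝ → ℝ := fun x => N x / (x * ((a : ℝ) + ((c : ℝ) - a) * x ^ c)) with hdC
  have hderB : ∀ x, 0 < x → HasDerivAt Bf (dB x) x := fun x hx => hasDerivAt_logBeta ha hab hbc hx
  have hderC : ∀ x, 0 < x → HasDerivAt Cf (dC x) x := fun x hx => hasDerivAt_logGamma ha hab hbc hx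
  have hNpos : ∀ x, ξ₁ < x → 0 < N x := by
    intro x hx
    have : ξ₁ ^ c < x ^ c := pow_lt_pow_left₀ hx hξ₁.le (by omega)
    show 0 < ((c : ℝ) - a) * ((c : ℝ) - b) * x ^ c - (a : ℝ) * b
    nlinarith [mul_pos hq0 hp0]
  -- the chord functional
  set F : ℝ → ℝ := fun x => (Bf x - Bf ξ₁) * (Cf ξ₂ - Cf ξ₁) - (Bf ξ₂ - Bf ξ₁) * (Cf x - Cf ξ₁) with hF
  set dF : ℝ → ℝ := fun x => dB x * (Cf ξ₂ - Cf ξ₁) - (Bf ξ₂ - Bf ξ₁) * dC x with hdF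
  have hF1 : F ξ₁ = 0 := by
    show (Bf ξ₁ - Bf ξ₁) * (Cf ξ₂ - Cf ξ₁) - (Bf ξ₂ - Bf ξ₁) * (Cf ξ₁ - Cf ξ₁) = 0; ring
  have hF2 : F ξ₂ = 0 := by
    show (Bf ξ₂ - Bf ξ₁) * (Cf ξ₂ - Cf ξ₁) - (Bf ξ₂ - Bf ξ₁) * (Cf ξ₂ - Cf ξ₁) = 0; ring
  have hderF : ∀ x, 0 < x → HasDerivAt F (dF x) x := by
    intro x hx
    exact (((hderB x hx).sub_const (Bf ξ₁)).mul_const (Cf ξ₂ - Cf ξ₁)).sub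
      (((hderC x hx).sub_const (Cf ξ₁)).const_mul (Bf ξ₂ - Bf ξ₁))
  have hcontF : ContinuousOn F (Icc ξ₁ ξ₂) := fun x hx =>
    (hderF x (lt_of_lt_of_le hξ₁ hx.1)).continuousAt.continuousWithinAt
  suffices hgoal : F ξs ≤ 0 by
    have : F ξs = (Bf ξs - Bf ξ₁) * (Cf ξ₂ - Cf ξ₁) - (Bf ξ₂ - Bf ξ₁) * (Cf ξs - Cf ξ₁) := rfl
    linarith
  by_contra hcon
  push Not at hcon
  have h1s' : ξ₁ < ξs := by
    rcases h1s.lt_or_eq with h | h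
    · exact h
    · exfalso; rw [← h, hF1] at hcon; exact lt_irrefl _ hcon
  have hs2' : ξs < ξ₂ := by
    rcases hs2.lt_or_eq with h | h
    · exact h
    · exfalso; rw [h, hF2] at hcon; exact lt_irrefl _ hcon
  have hξs0 : 0 < ξs := hξ₁.trans h1s'
  -- mean value theorem twice
  obtain ⟨r₁, hr₁, e₁⟩ := exists_hasDerivAt_eq_slope F dF h1s'
    (hcontF.mono (Icc_subset_Icc le_rfl hs2)) (fun x hx => hderF x (hξ₁.trans hx.1))
  obtain ⟨r₂, hr₂, e₂⟩ := exists_hasDerivAt_eq_slope F dF hs2'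
    (hcontF.mono (Icc_subset_Icc h1s le_rfl)) (fun x hx => hderF x (hξs0.trans hx.1))
  have hden1 : 0 < ξs - ξ₁ := sub_pos.mpr h1s'
  have hden2 : 0 < ξ₂ - ξs := sub_pos.mpr hs2'
  have hd1 : 0 < dF r₁ := by rw [e₁, hF1, sub_zero]; exact div_pos hcon hden1
  have hd2 : dF r₂ < 0 := by
    rw [e₂, hF2, zero_sub]; exact div_neg_of_neg_of_pos (neg_neg_of_pos hcon) hden2
  -- factorisation dF r = (N r / (r (b + p w)(a + q w))) · g(w),  g(w) = (C₂−C₁)(a + q w) − (B₂−B₁)(b + p w)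
  have hfac : ∀ r, 0 < r → dF r
      = N r / (r * ((b : ℝ) + ((c : ℝ) - b) * r ^ c) * ((a : ℝ) + ((c : ℝ) - a) * r ^ c))
        * ((Cf ξ₂ - Cf ξ₁) * ((a : ℝ) + ((c : ℝ) - a) * r ^ c) - (Bf ξ₂ - Bf ξ₁) * ((b : ℝ) + ((c : ℝ) - b) * r ^ c)) := by
    intro r hr
    have h1 : (b : ℝ) + ((c : ℝ) - b) * r ^ c ≠ 0 := by positivity
    have h2 : (a : ℝ) + ((c : ℝ) - a) * r ^ c ≠ 0 := by positivity
    show N r / (r * ((b : ℝ) + ((c : ℝ) - b) * r ^ c)) * (Cf ξ₂ - Cf ξ₁) - (Bf ξ₂ - Bf ξ₁) * (N r / (r * ((a : ℝ) + ((c : ℝ) - a) * r ^ c)))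
      = N r / (r * ((b : ℝ) + ((c : ℝ) - b) * r ^ c) * ((a : ℝ) + ((c : ℝ) - a) * r ^ c))
        * ((Cf ξ₂ - Cf ξ₁) * ((a : ℝ) + ((c : ℝ) - a) * r ^ c) - (Bf ξ₂ - Bf ξ₁) * ((b : ℝ) + ((c : ℝ) - b) * r ^ c))
    rw [div_mul_eq_mul_div, div_mul_eq_mul_div, mul_div_assoc', div_sub_div _ _ (mul_ne_zero hr.ne' h1) (mul_ne_zero hr.ne' h2),
      div_eq_div_iff (mul_ne_zero (mul_ne_zero hr.ne' h1) (mul_ne_zero hr.ne' h2)) (mul_ne_zero (mul_ne_zero hr.ne' h1) h2)]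
    ring
  have hcoef : ∀ r, ξ₁ < r → 0 < N r / (r * ((b : ℝ) + ((c : ℝ) - b) * r ^ c) * ((a : ℝ) + ((c : ℝ) - a) * r ^ c)) := by
    intro r hr
    have hr0 : 0 < r := hξ₁.trans hr
    have h1 : 0 < (b : ℝ) + ((c : ℝ) - b) * r ^ c := by positivity
    have h2 : 0 < (a : ℝ) + ((c : ℝ) - a) * r ^ c := by positivity
    exact div_pos (hNpos r hr) (by positivity)
  set g : ℝ → ℝ := fun w => (Cf ξ₂ - Cf ξ₁) * ((a : ℝ) + ((c : ℝ) - a) * w) - (Bf ξ₂ - Bf ξ₁) * ((b : ℝ) + ((c : ℝ) - b) * w) with hg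
  have hg1 : 0 < g (r₁ ^ c) := by
    rw [hfac r₁ (hξ₁.trans hr₁.1)] at hd1
    have hc' := hcoef r₁ hr₁.1
    by_contra hle
    push Not at hle
    have : N r₁ / (r₁ * ((b : ℝ) + ((c : ℝ) - b) * r₁ ^ c) * ((a : ℝ) + ((c : ℝ) - a) * r₁ ^ c)) * g (r₁ ^ c) ≤ 0 :=
      mul_nonpos_of_nonneg_of_nonpos hc'.le hle
    linarith
  have hg2 : g (r₂ ^ c) < 0 := by
    rw [hfac r₂ (hξs0.trans hr₂.1)] at hd2
    have hc' := hcoef r₂ (h1s'.trans hr₂.1)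
    by_contra hge
    push Not at hge
    have : 0 ≤ N r₂ / (r₂ * ((b : ℝ) + ((c : ℝ) - b) * r₂ ^ c) * ((a : ℝ) + ((c : ℝ) - a) * r₂ ^ c)) * g (r₂ ^ c) :=
      mul_nonneg hc'.le hge
    linarith
  -- g is affine with slope κ = (C₂−C₁)(c−a) − (B₂−B₁)(c−b); from g(w₁) > 0 > g(w₂), w₁ < w₂ we get κ < 0
  have hw : r₁ ^ c < r₂ ^ c := pow_lt_pow_left₀ (hr₁.2.trans hr₂.1) (hξ₁.trans hr₁.1).le (by omega)
  have hκneg : (Cf ξ₂ - Cf ξ₁) * ((c : ℝ) - a) - (Bf ξ₂ - Bf ξ₁) * ((c : ℝ) - b) < 0 := by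
    have e : g (r₂ ^ c) - g (r₁ ^ c)
        = ((Cf ξ₂ - Cf ξ₁) * ((c : ℝ) - a) - (Bf ξ₂ - Bf ξ₁) * ((c : ℝ) - b)) * (r₂ ^ c - r₁ ^ c) := by
      simp only [hg]; ring
    have hlt : g (r₂ ^ c) - g (r₁ ^ c) < 0 := by linarith
    rw [e] at hlt
    by_contra hk
    push Not at hk
    have : 0 ≤ ((Cf ξ₂ - Cf ξ₁) * ((c : ℝ) - a) - (Bf ξ₂ - Bf ξ₁) * ((c : ℝ) - b)) * (r₂ ^ c - r₁ ^ c) :=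
      mul_nonneg hk (by linarith)
    linarith
  -- but κ > 0: H = (c−a)·Cf − (c−b)·Bf is increasing on [ξ₁, ξ₂]
  set H : ℝ → ℝ := fun x => ((c : ℝ) - a) * Cf x - ((c : ℝ) - b) * Bf x with hH
  set dH : ℝ → ℝ := fun x => ((c : ℝ) - a) * dC x - ((c : ℝ) - b) * dB x with hdH
  have hderH : ∀ x, 0 < x → HasDerivAt H (dH x) x := fun x hx =>
    ((hderC x hx).const_mul ((c : ℝ) - a)).sub ((hderB x hx).const_mul ((c : ℝ) - b))
  have hcontH : ContinuousOn H (Icc ξ₁ ξ₂) := fun x hx =>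
    (hderH x (lt_of_lt_of_le hξ₁ hx.1)).continuousAt.continuousWithinAt
  have h12' : ξ₁ < ξ₂ := h1s'.trans hs2'
  obtain ⟨r, hr, e⟩ := exists_hasDerivAt_eq_slope H dH h12' hcontH (fun x hx => hderH x (hξ₁.trans hx.1))
  have hdHpos : 0 < dH r := by
    have hr0 : 0 < r := hξ₁.trans hr.1
    have h1 : 0 < (b : ℝ) + ((c : ℝ) - b) * r ^ c := by positivity
    have h2 : 0 < (a : ℝ) + ((c : ℝ) - a) * r ^ c := by positivity
    have e2 : dH r = N r / (r * ((b : ℝ) + ((c : ℝ) - b) * r ^ c) * ((a : ℝ) + ((c : ℝ) - a) * r ^ c))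
        * (((c : ℝ) - a) * (b : ℝ) - ((c : ℝ) - b) * (a : ℝ)) := by
      show ((c : ℝ) - a) * (N r / (r * ((a : ℝ) + ((c : ℝ) - a) * r ^ c))) - ((c : ℝ) - b) * (N r / (r * ((b : ℝ) + ((c : ℝ) - b) * r ^ c)))
        = N r / (r * ((b : ℝ) + ((c : ℝ) - b) * r ^ c) * ((a : ℝ) + ((c : ℝ) - a) * r ^ c))
          * (((c : ℝ) - a) * (b : ℝ) - ((c : ℝ) - b) * (a : ℝ))
      rw [mul_div_assoc', mul_div_assoc', div_mul_eq_mul_div,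
        div_sub_div _ _ (mul_ne_zero hr0.ne' h2.ne') (mul_ne_zero hr0.ne' h1.ne'),
        div_eq_div_iff (mul_ne_zero (mul_ne_zero hr0.ne' h2.ne') (mul_ne_zero hr0.ne' h1.ne')) (mul_ne_zero (mul_ne_zero hr0.ne' h1.ne') h2.ne')]
      ring
    rw [e2]
    exact mul_pos (hcoef r hr.1) (by nlinarith)
  rw [e] at hdHpos
  have hHlt : 0 < H ξ₂ - H ξ₁ := by
    have := div_pos_iff.mp hdHpos
    rcases this with ⟨h, _⟩ | ⟨_, h⟩
    · exact h
    · linarith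
  have : H ξ₂ - H ξ₁ = (Cf ξ₂ - Cf ξ₁) * ((c : ℝ) - a) - (Bf ξ₂ - Bf ξ₁) * ((c : ℝ) - b) := by
    simp only [hH]; ring
  rw [this] at hHlt
  linarith

end Chord

end Summit.ValiantsHypothesis.ValiantsHypothesis.Theorems.LacunarySymmetroidMatrixDescartes.Census.T4
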